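import Summits.Ventures.Crystal3D.Bulk.HullFaceSubtendedInduction
import Summits.Ventures.Crystal3D.Bulk.HullFanTiling
import Summits.Ventures.Crystal3D.Bulk.SubtendedAnglesHole
import Summits.Ventures.Crystal3D.Bulk.GapActiveFaces
import Summits.Ventures.Crystal3D.Bulk.GapFaceSizes
import HarnessLib

/-!
# Rattlers lie only in p-HEXAGONS: a face of the tight map of a census configuration whose corner
# fan contains a rattler direction has length `6` and passes through the hole — (d1)(d2) of
# `DESIGN-L12-THEORY.md` §P-L3 (d) / T2 §14 as a KERNEL theorem

HONEST FRAMING. Part of the venture `Summits/Ventures/Crystal3D` (cell `pub-crystal3d`, phase 2;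
seat p3). Kernel theorem about every configuration satisfying typer-bulk-2's `CensusRows c`
(`Bulk/GapCensusRows.lean`); nothing is claimed about GAP(1.26). The census prune (d1)(d2)
"rattlers (shell balls with no tight partner) lie only inside `p`-HEXAGONS" fixes the universe of
the enumeration (the `r`-strata, `TARGET-GAP.md` §4.4) and the faces on which the hole row may be
used; until now it was a paper premise (theory-2 §14). Here it becomes a census row:

* `CensusRows.subtended_active` — the generic winding / inner-path theorem
  (`HullRotSys.subtended_of_cover`, `Bulk/HullFaceSubtendedInduction.lean`) on the tight map
  inside the hull fan of the ACTIVE directions (as for Lemma L, `Bulk/GapActiveFaces.lean`);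
* **`CensusRows.six_le_ofaceLen_of_rattler`** — if a rattler direction `gapDir c j` lies in the
  CORNER FAN of the oriented face of a tight dart `q` (in the closed cone of a fan triangle of
  the active hull swept by a corner of that face, `HullRotSys.InCornerFan`), then
  `6 ≤ ofaceLen c q` (hence `= 6`, `CensusRows.ofaceLen_le_six`, and the face passes through the
  hole since `x`-only faces have `≤ 5` sides). Proof (§14): the sides of the hosting face subtend
  a total angle `≥ 2π` at the rattler (winding), while EVERY side subtends `≤ α₀ = arccos (1/3)`:
  a shell–shell side by Lemma 14.1 (`angle_perpTo_le_arccos_third`; its hypothesis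
  `∠zv + ∠zw ≤ 240°` is the inner-path row, all sides being `≤ 60°`), a hole side by Lemma 14.2
  (`angle_perpTo_le_arccos_third_of_hole`; its hypothesis `∠zv + ∠zp ≤ 180° + ρ` is the
  inner-path row, the OTHER hole side being the adjacent one); so `m·α₀ ≥ 2π > 5α₀`, `m ≥ 6`;
* `CensusRows.oface_meets_hole_of_rattler`, `CensusRows.rattler_not_mem_cone_of_xface` — (d1)
  for `x`-only faces as corollaries;
* **`CensusRows.exists_hexagon_of_rattler`** — EVERY rattler direction lies in the corner fan of
  some oriented face (the fan triangles tile space and the tight map covers the active hull,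
  `Bulk/HullFanTiling.lean`), which therefore has length `6` and passes through the hole. In
  particular a census configuration with a rattler has a `p`-hexagon.

The multiplicity bound (d3) (`≤ 2` / `≤ 1` rattlers per hexagon) is NOT here.
-/

noncomputable section

namespace Summit.Ventures.Crystal3D

open Literature.Geometry.DiscreteGeometry Finset Equiv HullRotSys Function Real InnerProductGeometry
open scoped InnerProductSpace

variable {c : Fin 14 → EuclideanSpace ℝ (Fin 3)}

/-! ## The generic theorem on the active hull -/

/-- **Winding and inner-path rows on the active hull.** For a tight dart `d` of a census
configuration and a unit vector `z`, not an active direction, in the corner fan of the face of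
`d`: `2π ≤ subtSum` and `SidesFar`. -/
theorem CensusRows.subtended_active (h : CensusRows c) {d : ↥(hullDarts (activeDirSet c))}
    (hd : d ∈ tightDartsIn c (activeDirSet c)) {z : EuclideanSpace ℝ (Fin 3)} (hz1 : ‖z‖ = 1)
    (hzX : z ∉ activeDirSet c)
    (hfan : InCornerFan h.isGapConfig.norm_of_mem_activeDirSet
      h.zero_mem_interior_convexHull_activeDirSet (tightDartsIn c (activeDirSet c)) d z) :
    2 * π ≤ subtSum h.isGapConfig.norm_of_mem_activeDirSet
        h.zero_mem_interior_convexHull_activeDirSet (tightDartsIn c (activeDirSet c)) d z ∧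
      SidesFar h.isGapConfig.norm_of_mem_activeDirSet
        h.zero_mem_interior_convexHull_activeDirSet (tightDartsIn c (activeDirSet c)) d z :=
  subtended_of_cover (isClosed_tightDartsIn c _) h.cover_active h.numK_active
    (fun _ hz => h.cornerAt_tightDartsIn_lt_pi _ _ h.dirPair_mem_hullDarts_active hz) hd hz1 hzX hfan

/-! ## Rattlers -/

/-- A rattler's direction is not an active direction. -/
theorem CensusRows.gapDir_not_mem_activeDirSet_of_rattler (h : CensusRows c) {j : Fin 14}
    (hj0 : j ≠ 0) (hratt : ∀ k : Fin 14, k ≠ 0 → k ≠ j → dist (c j) (c k) ≠ 1) :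
    gapDir c j ∉ activeDirSet c := by
  intro hmem
  obtain ⟨i, hi, he⟩ := mem_activeDirSet.1 hmem
  obtain ⟨hi0, ⟨k, hk⟩⟩ := mem_activeVertices.1 hi
  by_cases hij : i = j
  · subst hij
    obtain ⟨hk0, hkj, hdk⟩ := mem_tightNbrs.1 hk
    exact hratt k hk0 hkj hdk
  · have hD : intruderDist c < 2 := by linarith [h.intruderDist_le]
    exact h.isGapConfig.gapDir_ne hD hi0 hj0 hij he

/-- A rattler's direction is at inner product `≤ 1/2` from every active shell direction. -/
theorem CensusRows.inner_gapDir_rattler_le_half (h : CensusRows c) {j : Fin 14} (hj0 : j ≠ 0)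
    (hj13 : j ≠ 13) (hratt : ∀ k : Fin 14, k ≠ 0 → k ≠ j → dist (c j) (c k) ≠ 1) {i : Fin 14}
    (hi0 : i ≠ 0) (hi13 : i ≠ 13) (hi : (tightNbrs c i).Nonempty) :
    ⟪gapDir c j, gapDir c i⟫_ℝ ≤ 1 / 2 := by
  have hji : j ≠ i := by
    rintro rfl
    obtain ⟨k, hk⟩ := hi
    obtain ⟨hk0, hkj, hdk⟩ := mem_tightNbrs.1 hk
    exact hratt k hk0 hkj hdk
  have := h.isGapConfig.inner_gapDir_le hj0 hi0 hji
  rwa [tightLevel_of_ne hj13 hi13] at this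

/-- `arccos (1/2) = π/3`, inlined. -/
private theorem arccos_half' : arccos (1 / 2 : ℝ) = π / 3 := by
  rw [← Real.cos_pi_div_three, Real.arccos_cos (by positivity) (by linarith [Real.pi_pos])]

/-! ## (d1)(d2): the hosting face is a p-hexagon -/

/-- **(d1)(d2) Rattlers lie only in `p`-hexagons.** Let `q` be a dart of the tight map of a
census configuration and `j` a rattler whose direction lies in the corner fan of the oriented
face of `q`. Then that face has length `≥ 6` (so exactly `6`, through the hole). -/
theorem CensusRows.six_le_ofaceLen_of_rattler (h : CensusRows c) {q : Fin 14 × Fin 14}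
    (hq : q ∈ darts c) {j : Fin 14} (hj0 : j ≠ 0) (hj13 : j ≠ 13)
    (hratt : ∀ k : Fin 14, k ≠ 0 → k ≠ j → dist (c j) (c k) ≠ 1)
    (hfan : InCornerFan h.isGapConfig.norm_of_mem_activeDirSet
      h.zero_mem_interior_convexHull_activeDirSet (tightDartsIn c (activeDirSet c))
      ⟨dirPair c q, h.dirPair_mem_hullDarts_active q hq⟩ (gapDir c j)) :
    6 ≤ ofaceLen c q := by
  by_contra hlt
  push Not at hlt
  set z := gapDir c j with hzdef
  have hz1 : ‖z‖ = 1 := h.isGapConfig.norm_gapDir hj0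
  have hzX : z ∉ activeDirSet c := h.gapDir_not_mem_activeDirSet_of_rattler hj0 hratt
  obtain ⟨hP, hQ⟩ := h.subtended_active (mem_tightDartsIn.2 ⟨q, hq, rfl⟩) hz1 hzX hfan
  set m := ofaceLen c q with hmdef
  have hm3 : 3 ≤ m := h.three_le_ofaceLen hq
  have hm5 : m ≤ 5 := by omega
  have hper := h.facePeriod_active_eq hq
  have hv := h.faceVertex_active_eq hq
  -- the hole radius `κ = D/2 ∈ (1/2, 0.63]`
  set κ := intruderDist c / 2 with hκ
  have hκ1 : 1 / 2 ≤ κ := by rw [hκ]; linarith [h.one_lt_intruderDist]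
  have hκ2 : κ ≤ 7 / 10 := by rw [hκ]; linarith [h.intruderDist_le]
  have hρ3 : arccos κ ≤ π / 3 := by rw [← arccos_half']; exact Real.arccos_le_arccos hκ1
  -- the darts of the walk
  have hdart : ∀ t, (ofaceSucc c)^[t] q ∈ darts c := fun t => h.iterate_ofaceSucc_mem_darts hq t
  have hv0 : ∀ t, ((ofaceSucc c)^[t] q).1 ≠ 0 := fun t => (mem_darts.1 (hdart t)).1
  have hvact : ∀ t, (tightNbrs c ((ofaceSucc c)^[t] q).1).Nonempty :=
    fun t => ⟨_, snd_mem_tightNbrs_of_mem_darts (hdart t)⟩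
  have hv1 : ∀ t, ‖gapDir c ((ofaceSucc c)^[t] q).1‖ = 1 := fun t => h.isGapConfig.norm_gapDir (hv0 t)
  have hmod : ∀ t, (ofaceSucc c)^[t % m] q = (ofaceSucc c)^[t] q := fun t => by
    rw [hmdef, ofaceLen, iterate_mod_minimalPeriod_eq]
  -- sides: inner products and lengths
  have hvv : ∀ t, ⟪gapDir c ((ofaceSucc c)^[t] q).1, gapDir c ((ofaceSucc c)^[t + 1] q).1⟫_ℝ =
      tightLevel c ((ofaceSucc c)^[t] q).1 ((ofaceSucc c)^[t] q).2 := by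
    intro t
    rw [fst_iterate_succ]
    obtain ⟨h1, h2, -, hd⟩ := mem_darts.1 (hdart t)
    exact h.isGapConfig.inner_gapDir_eq h1 h2 hd
  have hside : ∀ t, angle (gapDir c ((ofaceSucc c)^[t] q).1) (gapDir c ((ofaceSucc c)^[t + 1] q).1) =
      arccos (tightLevel c ((ofaceSucc c)^[t] q).1 ((ofaceSucc c)^[t] q).2) := by
    intro t; rw [angle_eq_arccos_inner_of_norm_one (hv1 t) (hv1 (t + 1)), hvv t]
  have hside_le : ∀ t, angle (gapDir c ((ofaceSucc c)^[t] q).1) (gapDir c ((ofaceSucc c)^[t + 1] q).1)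
      ≤ π / 3 := by
    intro t; rw [hside t, ← arccos_half']
    exact Real.arccos_le_arccos (h.isGapConfig.half_le_tightLevel _ _)
  have hside_hole : ∀ t, ((ofaceSucc c)^[t] q).1 = 13 ∨ ((ofaceSucc c)^[t] q).2 = 13 →
      angle (gapDir c ((ofaceSucc c)^[t] q).1) (gapDir c ((ofaceSucc c)^[t + 1] q).1) = arccos κ := by
    intro t ht
    rw [hside t]
    rcases ht with h1 | h2
    · rw [h1, tightLevel_of_left]
    · rw [h2, tightLevel_of_right]
  -- the rattler against the vertices
  have hzv : ∀ t, ((ofaceSucc c)^[t] q).1 ≠ 13 → ⟪z, gapDir c ((ofaceSucc c)^[t] q).1⟫_ℝ ≤ 1 / 2 :=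
    fun t ht => h.inner_gapDir_rattler_le_half hj0 hj13 hratt (hv0 t) ht (hvact t)
  have hzp : ⟪z, gapDir c 13⟫_ℝ ≤ κ := by
    have := h.isGapConfig.inner_gapDir_le hj0 (by decide : (13 : Fin 14) ≠ 0) hj13
    rwa [tightLevel_of_right] at this
  -- the perimeter
  have hperim : perim h.isGapConfig.norm_of_mem_activeDirSet
      h.zero_mem_interior_convexHull_activeDirSet (tightDartsIn c (activeDirSet c))
      ⟨dirPair c q, h.dirPair_mem_hullDarts_active q hq⟩ =
      ∑ t ∈ range m, angle (gapDir c ((ofaceSucc c)^[t] q).1) (gapDir c ((ofaceSucc c)^[t + 1] q).1) := by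
    unfold perim; rw [hper, ← hmdef]; simp only [hv]
  have hperim_le : ∑ t ∈ range m, angle (gapDir c ((ofaceSucc c)^[t] q).1)
      (gapDir c ((ofaceSucc c)^[t + 1] q).1) ≤ m * (π / 3) := by
    calc ∑ t ∈ range m, angle (gapDir c ((ofaceSucc c)^[t] q).1) (gapDir c ((ofaceSucc c)^[t + 1] q).1)
        ≤ ∑ t ∈ range m, π / 3 := Finset.sum_le_sum fun t _ => hside_le t
      _ = m * (π / 3) := by rw [Finset.sum_const, card_range, nsmul_eq_mul]
  -- two distinct hole sides leave at most `m − 2` sides of length `≤ π/3`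
  have hperim_le2 : ∀ t t' : ℕ, t < m → t' < m → t ≠ t' →
      angle (gapDir c ((ofaceSucc c)^[t] q).1) (gapDir c ((ofaceSucc c)^[t + 1] q).1) = arccos κ →
      angle (gapDir c ((ofaceSucc c)^[t'] q).1) (gapDir c ((ofaceSucc c)^[t' + 1] q).1) = arccos κ →
      ∑ s ∈ range m, angle (gapDir c ((ofaceSucc c)^[s] q).1) (gapDir c ((ofaceSucc c)^[s + 1] q).1)
        ≤ 2 * arccos κ + (m - 2 : ℕ) * (π / 3) := by
    intro t t' ht ht' htt' e1 e2
    set f : ℕ → ℝ := fun s => angle (gapDir c ((ofaceSucc c)^[s] q).1)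
      (gapDir c ((ofaceSucc c)^[s + 1] q).1) with hf
    have hmem : t ∈ range m := mem_range.2 ht
    have hmem' : t' ∈ (range m).erase t := mem_erase.2 ⟨htt'.symm, mem_range.2 ht'⟩
    rw [← Finset.add_sum_erase _ f hmem, ← Finset.add_sum_erase _ f hmem']
    have hcard : (((range m).erase t).erase t').card = m - 2 := by
      rw [card_erase_of_mem hmem', card_erase_of_mem hmem, card_range]; omega
    have hrest : ∑ s ∈ ((range m).erase t).erase t', f s ≤ (m - 2 : ℕ) * (π / 3) := by
      calc ∑ s ∈ ((range m).erase t).erase t', f s ≤ ∑ s ∈ ((range m).erase t).erase t', π / 3 :=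
            Finset.sum_le_sum fun s _ => hside_le s
        _ = (m - 2 : ℕ) * (π / 3) := by rw [Finset.sum_const, hcard, nsmul_eq_mul]
    have e1' : f t = arccos κ := e1
    have e2' : f t' = arccos κ := e2
    linarith
  -- every side subtends `≤ α₀` at `z`
  have hω : ∀ t, t < m → angle (perpTo z (gapDir c ((ofaceSucc c)^[t] q).1))
      (perpTo z (gapDir c ((ofaceSucc c)^[t + 1] q).1)) ≤ arccos (1 / 3) := by
    intro t ht
    have hrow := hQ t (by rw [hper]; exact ht)
    rw [hperim, hv, hv] at hrow
    have hm5' : (m : ℝ) ≤ 5 := by exact_mod_cast hm5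
    by_cases h2 : ((ofaceSucc c)^[t] q).2 = 13
    · -- side INTO the hole: `v_{t+1} = p`; the next side also touches the hole
      have h1 : ((ofaceSucc c)^[t] q).1 ≠ 13 := by
        intro h1; exact (mem_darts.1 (hdart t)).2.2.1 (h1.trans h2.symm)
      have hp : ((ofaceSucc c)^[t + 1] q).1 = 13 := by rw [fst_iterate_succ]; exact h2
      have et : angle (gapDir c ((ofaceSucc c)^[t] q).1) (gapDir c ((ofaceSucc c)^[t + 1] q).1) =
          arccos κ := hside_hole t (Or.inr h2)
      -- the other hole side `t' = (t+1) % m`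
      have et' : angle (gapDir c ((ofaceSucc c)^[(t + 1) % m] q).1)
          (gapDir c ((ofaceSucc c)^[(t + 1) % m + 1] q).1) = arccos κ := by
        refine hside_hole _ (Or.inl ?_)
        rw [hmod]; exact hp
      have hne : t ≠ (t + 1) % m := by
        intro he
        rcases Nat.lt_or_ge (t + 1) m with hl | hl
        · rw [Nat.mod_eq_of_lt hl] at he; omega
        · have : t + 1 = m := by omega
          rw [this, Nat.mod_self] at he; omega
      have hP2 := hperim_le2 t ((t + 1) % m) ht (Nat.mod_lt _ (by omega)) hne et et'
      rw [et] at hrow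
      have hm2 : ((m - 2 : ℕ) : ℝ) ≤ 3 := by
        have : m - 2 ≤ 3 := by omega
        exact_mod_cast this
      have hsum : angle z (gapDir c ((ofaceSucc c)^[t] q).1) + angle z (gapDir c ((ofaceSucc c)^[t + 1] q).1)
          ≤ π + arccos κ := by nlinarith [Real.pi_pos, Real.arccos_nonneg κ]
      rw [hp]
      rw [hp] at hsum
      have hvp : ⟪gapDir c ((ofaceSucc c)^[t] q).1, gapDir c 13⟫_ℝ = κ := by
        have := hvv t; rw [hp, h2, tightLevel_of_right] at this; exact this
      exact angle_perpTo_le_arccos_third_of_hole hz1 (hv1 t) (h.isGapConfig.norm_gapDir (by decide))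
        hκ1 hκ2 hvp (hzv t h1) hzp hsum
    by_cases h1 : ((ofaceSucc c)^[t] q).1 = 13
    · -- side OUT OF the hole: `v_t = p`; the previous side also touches the hole
      have h2' : ((ofaceSucc c)^[t + 1] q).1 ≠ 13 := by rw [fst_iterate_succ]; exact h2
      have et : angle (gapDir c ((ofaceSucc c)^[t] q).1) (gapDir c ((ofaceSucc c)^[t + 1] q).1) =
          arccos κ := hside_hole t (Or.inl h1)
      -- the other hole side `t'' = (t + m - 1) % m`, whose head is `v_t = p`
      have hsucc : (ofaceSucc c)^[(t + m - 1) % m + 1] q = (ofaceSucc c)^[t] q := by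
        rcases Nat.eq_zero_or_pos t with ht0 | ht0
        · rw [ht0, zero_add, Nat.mod_eq_of_lt (by omega : m - 1 < m), show m - 1 + 1 = m by omega,
            iterate_zero_apply, hmdef, iterate_ofaceLen]
        · rw [show t + m - 1 = (t - 1) + m by omega, Nat.add_mod_right,
            Nat.mod_eq_of_lt (by omega : t - 1 < m), show t - 1 + 1 = t by omega]
      have et'' : angle (gapDir c ((ofaceSucc c)^[(t + m - 1) % m] q).1)
          (gapDir c ((ofaceSucc c)^[(t + m - 1) % m + 1] q).1) = arccos κ := by
        refine hside_hole _ (Or.inr ?_)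
        rw [← fst_iterate_succ, hsucc]; exact h1
      have hne : t ≠ (t + m - 1) % m := by
        intro he
        rcases Nat.eq_zero_or_pos t with ht0 | ht0
        · rw [ht0, zero_add, Nat.mod_eq_of_lt (by omega : m - 1 < m)] at he; omega
        · rw [show t + m - 1 = (t - 1) + m by omega, Nat.add_mod_right,
            Nat.mod_eq_of_lt (by omega : t - 1 < m)] at he; omega
      have hP2 := hperim_le2 t ((t + m - 1) % m) ht (Nat.mod_lt _ (by omega)) hne et et''
      rw [et] at hrow
      have hm2 : ((m - 2 : ℕ) : ℝ) ≤ 3 := by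
        have : m - 2 ≤ 3 := by omega
        exact_mod_cast this
      have hsum : angle z (gapDir c ((ofaceSucc c)^[t + 1] q).1) + angle z (gapDir c ((ofaceSucc c)^[t] q).1)
          ≤ π + arccos κ := by nlinarith [Real.pi_pos, Real.arccos_nonneg κ]
      rw [h1, angle_comm]
      rw [h1] at hsum
      have hvp : ⟪gapDir c ((ofaceSucc c)^[t + 1] q).1, gapDir c 13⟫_ℝ = κ := by
        have := hvv t; rw [h1, real_inner_comm, tightLevel_of_left] at this; exact this
      exact angle_perpTo_le_arccos_third_of_hole hz1 (hv1 (t + 1)) (h.isGapConfig.norm_gapDir (by decide))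
        hκ1 hκ2 hvp (hzv (t + 1) h2') hzp hsum
    · -- a shell–shell side: Lemma 14.1
      have h2' : ((ofaceSucc c)^[t + 1] q).1 ≠ 13 := by rw [fst_iterate_succ]; exact h2
      have et : angle (gapDir c ((ofaceSucc c)^[t] q).1) (gapDir c ((ofaceSucc c)^[t + 1] q).1) = π / 3 := by
        rw [hside t, tightLevel_of_ne h1 h2, arccos_half']
      have hvw : ⟪gapDir c ((ofaceSucc c)^[t] q).1, gapDir c ((ofaceSucc c)^[t + 1] q).1⟫_ℝ = 1 / 2 := by
        rw [hvv t, tightLevel_of_ne h1 h2]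
      rw [et] at hrow
      refine angle_perpTo_le_arccos_third hz1 (hv1 t) (hv1 (t + 1)) hvw (hzv t h1) (hzv (t + 1) h2') ?_
      nlinarith [Real.pi_pos]
  -- the winding sum is `≤ m α₀ ≤ 5 α₀ < 2π`
  have hsum : subtSum h.isGapConfig.norm_of_mem_activeDirSet
      h.zero_mem_interior_convexHull_activeDirSet (tightDartsIn c (activeDirSet c))
      ⟨dirPair c q, h.dirPair_mem_hullDarts_active q hq⟩ z ≤ m * arccos (1 / 3) := by
    unfold subtSum
    rw [hper, ← hmdef]
    simp only [hv]
    calc ∑ t ∈ range m, angle (perpTo z (gapDir c ((ofaceSucc c)^[t] q).1))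
          (perpTo z (gapDir c ((ofaceSucc c)^[t + 1] q).1))
        ≤ ∑ t ∈ range m, arccos (1 / 3) := Finset.sum_le_sum fun t ht => hω t (mem_range.1 ht)
      _ = m * arccos (1 / 3) := by rw [Finset.sum_const, card_range, nsmul_eq_mul]
  have hα0 : 0 ≤ arccos (1 / 3) := Real.arccos_nonneg _
  have hm5' : (m : ℝ) ≤ 5 := by exact_mod_cast hm5
  have h5 := five_mul_arccos_third_lt_two_pi
  nlinarith

/-! ## Corollaries: (d1) for x-only faces; every rattler is hosted by a p-hexagon -/

/-- **(d1) No rattler direction lies in an `x`-only face**: if the direction of a rattler lies in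
the corner fan of the oriented face of `q`, that face passes through the hole. -/
theorem CensusRows.oface_meets_hole_of_rattler (h : CensusRows c) {q : Fin 14 × Fin 14}
    (hq : q ∈ darts c) {j : Fin 14} (hj0 : j ≠ 0) (hj13 : j ≠ 13)
    (hratt : ∀ k : Fin 14, k ≠ 0 → k ≠ j → dist (c j) (c k) ≠ 1)
    (hfan : InCornerFan h.isGapConfig.norm_of_mem_activeDirSet
      h.zero_mem_interior_convexHull_activeDirSet (tightDartsIn c (activeDirSet c))
      ⟨dirPair c q, h.dirPair_mem_hullDarts_active q hq⟩ (gapDir c j)) :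
    ∃ t, t < ofaceLen c q ∧ ((ofaceSucc c)^[t] q).1 = 13 := by
  by_contra hx
  push Not at hx
  have h5 := h.ofaceLen_le_five_of_forall_ne hq hx
  have h6 := h.six_le_ofaceLen_of_rattler hq hj0 hj13 hratt hfan
  omega

/-- **(d1), simplest instance.** For a dart `q = (a, b)` of an `x`-only face and a rattler `j`,
`gapDir c j` is NOT a nonnegative combination of `gapDir c b`, `gapDir c a` and the third vertex
of the fan triangle of the active hull on the right of the dart. -/
theorem CensusRows.rattler_not_mem_cone_of_xface (h : CensusRows c) {q : Fin 14 × Fin 14}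
    (hq : q ∈ darts c) (hx : ∀ t, t < ofaceLen c q → ((ofaceSucc c)^[t] q).1 ≠ 13)
    {j : Fin 14} (hj0 : j ≠ 0) (hj13 : j ≠ 13)
    (hratt : ∀ k : Fin 14, k ≠ 0 → k ≠ j → dist (c j) (c k) ≠ 1) {α β γ : ℝ} (hα : 0 ≤ α)
    (hβ : 0 ≤ β) (hγ : 0 ≤ γ) :
    gapDir c j ≠ α • gapDir c q.2 + β • gapDir c q.1 +
      γ • succV (activeDirSet c) (gapDir c q.2) (gapDir c q.1) := by
  intro heq
  set d : ↥(hullDarts (activeDirSet c)) := ⟨dirPair c q, h.dirPair_mem_hullDarts_active q hq⟩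
  have hfan : InCornerFan h.isGapConfig.norm_of_mem_activeDirSet
      h.zero_mem_interior_convexHull_activeDirSet (tightDartsIn c (activeDirSet c)) d (gapDir c j) := by
    refine ⟨0, 0, ?_, ?_⟩
    · rw [faceDart_zero]
      exact (RotSys.retTime_spec _ (isClosed_tightDartsIn c _ _ (mem_tightDartsIn.2 ⟨q, hq, rfl⟩))).1
    · rw [faceDart_zero, pow_zero, Perm.one_apply]
      exact ⟨α, β, γ, hα, hβ, hγ, heq⟩
  obtain ⟨t, ht, ht13⟩ := h.oface_meets_hole_of_rattler hq hj0 hj13 hratt hfan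
  exact hx t ht ht13

/-- **Every rattler is hosted by a `p`-hexagon.** For every rattler `j` of a census configuration
there is a dart `q` of the tight map whose oriented face has the direction `gapDir c j` in its
corner fan; every such face has length exactly `6` and passes through the hole. -/
theorem CensusRows.exists_hexagon_of_rattler (h : CensusRows c) {j : Fin 14} (hj0 : j ≠ 0)
    (hj13 : j ≠ 13) (hratt : ∀ k : Fin 14, k ≠ 0 → k ≠ j → dist (c j) (c k) ≠ 1) :
    ∃ q : Fin 14 × Fin 14, ∃ hq : q ∈ darts c,
      InCornerFan h.isGapConfig.norm_of_mem_activeDirSet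
          h.zero_mem_interior_convexHull_activeDirSet (tightDartsIn c (activeDirSet c))
          ⟨dirPair c q, h.dirPair_mem_hullDarts_active q hq⟩ (gapDir c j) ∧
        ofaceLen c q = 6 ∧ ∃ t, t < ofaceLen c q ∧ ((ofaceSucc c)^[t] q).1 = 13 := by
  obtain ⟨d, hd, hfan⟩ := exists_inCornerFan_of_cover
    (hX1 := h.isGapConfig.norm_of_mem_activeDirSet)
    (h0 := h.zero_mem_interior_convexHull_activeDirSet) (isClosed_tightDartsIn c _)
    h.cover_active (gapDir c j)
  obtain ⟨q, hq, hqd⟩ := mem_tightDartsIn.1 hd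
  have hdq : d = ⟨dirPair c q, h.dirPair_mem_hullDarts_active q hq⟩ := Subtype.ext hqd.symm
  subst hdq
  exact ⟨q, hq, hfan, le_antisymm (h.ofaceLen_le_six hq)
    (h.six_le_ofaceLen_of_rattler hq hj0 hj13 hratt hfan),
    h.oface_meets_hole_of_rattler hq hj0 hj13 hratt hfan⟩

end Summit.Ventures.Crystal3D
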